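/-
Copyright (c) 2026 the pub-hodgecm-mathlib formalisation cell (harness21).  Prover seat hodgecm-mathlib-K2E3-p26 (g3), Track B «K2-LIT»,
#184♮ = hLiu418 = `stmt-HodgeConjecture-24832`; socket #41, KIND W, (iii-fin) row (KW-fin-supp) — KW desk F0P2-p08 (g3) FOUR WORDS 2026-09-05T00:27:19Z (d), second
option: THE LEVEL OF THE (KW-fac) `FvT` READING = the payer of the level-invariance letter `hFinv` of K2E3-p03 (g9)'s `K2LiuKindWFiniteSupportLetterOfLevel` §5, in the
★ (c1) ∕ ★ (c5) ∕ 📤 (ρ5) LEVEL currency `K_w(ϖ_w^m) = congruenceGL N (valuation ϖ_w ^ m)`.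
THEOREMS ONLY (no `def`, no `instance`, no notation, no named-fact hypothesis, no `sorry`); lane `--supports stmt-HodgeConjecture-24832` (count-neutral helper).
-/
import Summits.HodgeConjecture.HodgeConjecture.Theorems.K2LiuKindWFactorizationReadings   -- ★ p863597 (this seat): the (KW-fac) reading (`hread` bytes, `kindWFinset`, `localDegPS`, `LambdaLoc`, `modDelta`, `IwasawaDatum.IsStd`)
import Summits.HodgeConjecture.HodgeConjecture.Theorems.K2LiuKindOneLineLevelConjugation     -- ★ (c5) p863136 (this seat's lineage): `evalPlace_finPart_conj_apply_mem_congruenceGL` over ★ (c1); brings `congruenceGL`, `GLn.localHeight`, `localPi ≤ LocalGLPi`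
import Literature.NumberTheory.Automorphic.CongruenceSubgroupExpansionGL                     -- ★ `exists_congruenceGL_pow_subset` (the `K_m` are a neighbourhood basis of `1` in `GL_N`)
import Literature.NumberTheory.Automorphic.AdicCompletionLocalField                          -- ★ instances `ValuativeRel ∕ IsNonarchimedeanLocalField (w.adicCompletion L)`
import HarnessLib

/-!
# Crux `HLiu418`, socket #41, KIND W — `K2LiuKindWFactorLevelInvariance`: THE LOCAL FACTORS OF THE (KW-fac) READING HAVE A PRINCIPAL LEVEL
# (`FvT j S h v s (y·k) = FvT j S h v s (y)` for `k ∈ ∏_{w∣v} K_w(ϖ_w^{c_w})`, ONE `c` with finite support), AND ITS CONJUGATED FORM ALONG AN ADELIC POINT OF BOUNDED LOCAL HEIGHT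

Cell `hodgecm-mathlib`, crux item hLiu418 = `stmt-HodgeConjecture-24832` (helper lane `--supports … --as helper`, count-neutral), route of record `HCCMUnconditional`;
squad K2 ∕ K2Liu, road `K2_Liu`, socket #41 `sig_K2LiuSiegelEisensteinContinuation`, KIND W, (iii-fin) row; author K2E3-p26 (g3); KW desk F0P2-p08 (g3).
THE MATHEMATICS [BorelJacquet1979, §4.1], [Casselman1980, §3], [PlatonovRapinchuk1994, §5.1], [HarishChandra1999, §17], [Tan1999, §1 p. 166], [HarrisKudlaSweet1996, §1 (1.15)].
The (KW-fac) reading (★ p863379 ∕ ★ p863597) of the local factors of a STANDARD section family is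
`FvT j S h v s y = if v ∈ S₀ then H_v(y)^{2(s−s₀)}·b_{j,v}(y) else Λ_{s,v}(y)`, `H_v = Φ_𝒦 ∘ ι_v` (`modDelta ∘ 𝒦.pPart ∘ locToAdelic v`).  Each factor is right-invariant under a
compact open subgroup of `H(L⁺_v)`, UNIFORMLY in `(j, s, S, h)`: off `S₀` the unramified section `Λ_{s,v}` is right-`K_{H,v}`-invariant (★ `lambdaLoc_mul_localInt`, `χ` unramified
above `v`); on `S₀` the factor `b_{j,v} ∈ I_v(s₀, χ_v)` is SMOOTH (★ `mem_localDegPS_iff`) and `Φ_𝒦` is right-`𝒦.K`-invariant (★ `iwasawaHeight_mul_K`) with `ι_v⁻¹(𝒦.K)` open for a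
STANDARD datum (★ `IwasawaDatum.IsStd.exists_fin`).  An open neighbourhood of `1` in `H(L⁺_v) ≤ Π_{w∣v} GL_N(L_w)` contains a principal level `∏_w K_w(ϖ_w^{m_w})` (§1 — the LOCAL
form of 📤 (ρ5); ★ `exists_congruenceGL_pow_subset` place by place), whence ONE exponent function `c : (places of L) → ℕ`, vanishing off the places over `S₀`, in the `(Tc, c, hc)`
bytes of ★ p863047 ∕ ★ p863485's `hsuppLoc`.  Conjugating by the `v`-component of an adelic point `x` of local heights `H_w(x) ≤ q_w^{a_w}` costs `2a_w` levels (★ (c1) ∕ ★ (c5)), which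
is the shape of K2E3-p03's `hFinv` («`FvT(W_v·(y u₀)·h_v) = FvT(W_v·y·h_v)`»).
* §1 (generic frame `F E c N J v`, as ★ (c5)) **`exists_levels_forall_mem_of_mem_nhds`** — a neighbourhood of `1` in `localPi E c N J v` contains `{u | ∀ w ∣ v, u_w ∈ K_w(ϖ_w^{m_w})}`;
  **`apply_mul_mul_evalPlace_eq_of_levels`** — a function of level `c` at `v` is of level `c + 2a` after the right translate by `x_v`, `H_w(x) ≤ q_w^{a_w}` (★ (c5) over ★ (c1)).
* §2 **`modDelta_pPart_locToAdelic_mul`** (`ι_v k ∈ 𝒦.K ⇒ H_v(y k) = H_v(y)`), **`exists_levels_locToAdelic_mem_K`** (a STANDARD datum: a level at `v` inside `ι_v⁻¹(𝒦.K)`).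
* §3 **`exists_levels_forall_mul_eq_of_isSmooth`** (finitely many SMOOTH functions have a common level), **`exists_levels_factors_and_mem_K`** (the `S₀`-factors at one place),
  HEAD **`exists_levels_forall_FvT_mul_eq`** — `∃ Tc c, (∀ w ∉ Tc, c w = 0) ∧ ∀ j S h v s y k, (∀ w ∣ v, k_w ∈ K_w(ϖ_w^{c_w})) → FvT j S h v s (y * k) = FvT j S h v s y`.
* §4 **`FvT_mul_mul_eq_of_levels`** (LOCAL form: right translate by `g ∈ H(L⁺_v)` with entry bounds `q_w^{a_w}`, `k_w ∈ K_w(ϖ_w^{c_w + 2a_w})` ⇒ `FvT(y·k·g) = FvT(y·g)`) and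
  **`FvT_mul_mul_evalPlace_eq`** (ADELIC form at `g := x_v = evalPlace v (finPart x)`, `H_w(x) ≤ q_w^{a_w}`) — K2E3-p03's `hFinv` body at `y := W_v·y`, `k := u₀`, `x := h`, in LEVEL currency.
NOT HERE: the step «`u₀ ∈ kindWLocalBall v (π v) a₀` ⇒ `(u₀)_w ∈ K_w(ϖ_w^{…})`» ((lat-a) ★ `K2LiuUnipotentDeepLevel.nElem_apply_mem_congruenceGL_pow`, `|2|_w = 1`; the 2-adic ∕ ramified
defect is F0P2-p09's `D`); the dual-lattice letter `hdual` (F0P2-p09 `K2LiuKindWFiniteDualLatticeLetter`).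

HONEST LABEL.  Count-neutral helper; it retires nothing by itself: `HC_CM` is proved only modulo the 7 printed citations (2 remaining named inputs:
hLiu418 = `stmt-HodgeConjecture-24832`, h413 = `stmt-HodgeConjecture-24833`) until rung 0 closes.

## References
* [BorelJacquet1979] A. Borel, H. Jacquet, *Automorphic forms and automorphic representations*, Proc. Sympos. Pure Math. 33.1 (1979), §4.1 (levels of smooth vectors, `K = ∏_v K_v`).
* [Casselman1980] W. Casselman, *The unramified principal series of p-adic groups I*, Compositio Math. 40 (1980), §3 (smooth = fixed by a compact open subgroup).
* [PlatonovRapinchuk1994] V. Platonov, A. Rapinchuk, *Algebraic Groups and Number Theory* (1994), §5.1 (principal congruence subgroups are a base of neighbourhoods of `1`).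
* [HarishChandra1999] Harish-Chandra (DeBacker–Sally, eds.), *Admissible invariant distributions on reductive p-adic groups*, ULS 16 (1999), §17 (conjugating levels by bounded elements).
* [Tan1999] V. Tan, *Poles of Siegel Eisenstein series on U(n,n)*, Canad. J. Math. 51 (1999), §1 p. 166 (standard sections, `K`-types).
* [HarrisKudlaSweet1996] M. Harris, S. Kudla, W. J. Sweet, *Theta dichotomy for unitary groups*, J. AMS 9 (1996), §1 (1.15) (`I_v(s, χ_v)`, smooth sections).
-/

set_option autoImplicit false
-- the mandated namespace repeats the single-problem summit's segment (`HodgeConjecture.HodgeConjecture`)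
set_option linter.dupNamespace false

noncomputable section

open scoped Matrix NNReal MatrixGroups WithZero Topology
open Filter Set NumberField IsDedekindDomain Matrix ValuativeRel
open Literature.NumberTheory.Automorphic hiding IsKFinite
open Literature.NumberTheory.Automorphic.UnitaryGroup Literature.NumberTheory.GaloisRepresentations
open Literature.NumberTheory.GaloisRepresentations.IsNonarchimedeanLocalField
open Literature.NumberTheory.GelbartRogawski1991 Literature.NumberTheory.GelbartRogawski1991.GRConstruction
open Literature.NumberTheory.GelbartRogawski1991.UnitaryDualPair Literature.NumberTheory.GelbartRogawski1991.UnitaryDualPair.LocalSplitting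
open Literature.NumberTheory.K2Lit.SiegelDoubled Literature.NumberTheory.K2Lit.LocalSiegelDoubled Literature.NumberTheory.K2Lit.PlaceSplitting
open Summit.HodgeConjecture.HodgeConjecture.Cruxes.HLiu418.K2LiuSiegelUnipotentFourierDefs (skewMatrices)
open Summit.HodgeConjecture.HodgeConjecture.Cruxes.HLiu418.K2LiuSiegelEisensteinKindWLetters (kindWFinset)
open Summit.HodgeConjecture.HodgeConjecture.Cruxes.HLiu418.K2LiuIwasawaHeightContinuous (iwasawaHeight_mul_K)
open Summit.HodgeConjecture.HodgeConjecture.Cruxes.HLiu418.K2LiuKindOneLineLevelConjugation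
  (conj_apply_mem_congruenceGL evalPlace_finPart_conj_apply_mem_congruenceGL nnnorm_evalPlace_finPart_apply_le)

namespace Summit.HodgeConjecture.HodgeConjecture.Cruxes.HLiu418.K2LiuKindWFactorLevelInvariance

/-! ## §1 A neighbourhood of `1` in `H(F_v) = localPi ≤ Π_{w ∣ v} GL_N(E_w)` contains a principal level `∏_{w∣v} K_w(ϖ_w^{m_w})` -/

section Local

variable (F : Type) [Field F] [NumberField F] (E : Type) [Field E] [NumberField E] [Algebra F E] (c : E ≃ₐ[F] E) (N : ℕ) (J : Matrix (Fin N) (Fin N) E)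
  (v : HeightOneSpectrum (𝓞 F))

/-- **THE PRINCIPAL LEVELS ARE A NEIGHBOURHOOD BASIS OF `1` IN `H(F_v)`** (the LOCAL form of 📤 (ρ5) `exists_finset_forall_evalAt_mem_congruenceGL_imp_mem`): for `U ∈ 𝓝 1` in
`localPi E c N J v ≤ Π_{w∣v} GL_N(E_w)` and uniformisers `ϖ_w` (`|ϖ_w|_w = exp(−1)`) there are exponents `m_w`, `w ∣ v`, with `u ∈ U` whenever `u_w ∈ K_w(ϖ_w^{m_w}) = congruenceGL N (valuation ϖ_w ^ m_w)`
for every `w ∣ v` (subspace + product topology, Mathlib `mem_nhds_induced` ∕ `nhds_pi` ∕ `Filter.mem_pi`; ★ `exists_congruenceGL_pow_subset` in each `GL_N(E_w)`, ★ `isUniformizingElement_of_v_eq`).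
[cite: PlatonovRapinchuk1994, §5.1] [cite: BorelJacquet1979, §4.1] -/
theorem exists_levels_forall_mem_of_mem_nhds {U : Set (localPi E c N J v)} (hU : U ∈ 𝓝 (1 : localPi E c N J v))
    (ϖ : (w : PlacesOver E v) → w.1.adicCompletion E) (hϖ : ∀ w, Valued.v (ϖ w) = WithZero.exp (-1 : ℤ)) :
    ∃ m : PlacesOver E v → ℕ, ∀ u : localPi E c N J v,
      (∀ w : PlacesOver E v, (u : LocalGLPi E N v) w ∈ congruenceGL N (valuation (w.1.adicCompletion E) (ϖ w) ^ m w)) → u ∈ U := by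
  obtain ⟨V, hV, hVU⟩ := (mem_nhds_induced Subtype.val (1 : localPi E c N J v) U).1 hU
  rw [OneMemClass.coe_one, nhds_pi, Filter.mem_pi] at hV
  obtain ⟨I, -, t, ht, htV⟩ := hV
  have hm : ∀ w : PlacesOver E v, ∃ m : ℕ,
      (congruenceGL N (valuation (w.1.adicCompletion E) (ϖ w) ^ m) : Set (GL (Fin N) (w.1.adicCompletion E))) ⊆ t w := fun w => by
    obtain ⟨m, -, hm⟩ := exists_congruenceGL_pow_subset (n := N) (isUniformizingElement_of_v_eq (hϖ w)) (ht w)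
    exact ⟨m, hm⟩
  choose m hm using hm
  exact ⟨m, fun u hu => hVU (htV fun w _ => hm w (hu w))⟩

/-- **A FUNCTION OF LEVEL `c` AT `v` IS OF LEVEL `c + 2a` AFTER A RIGHT TRANSLATE BY `x_v`, `H_w(x) ≤ q_w^{a_w}`**: if `Φ(y·k) = Φ(y)` whenever `k_w ∈ K_w(ϖ_w^{c_w})` for all `w ∣ v`, then for
an adelic point `x` with local heights `H_w(x) ≤ q_w^{a_w}` (`w ∣ v`) and `k` with `k_w ∈ K_w(ϖ_w^{c_w + 2a_w})`, `Φ(y·k·x_v) = Φ(y·x_v)`, `x_v = evalPlace v (finPart x)` —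
`y·k·x_v = (y·x_v)·(x_v⁻¹·k·x_v)` and ★ (c5) `evalPlace_finPart_conj_apply_mem_congruenceGL` (over ★ (c1)). [cite: HarishChandra1999, §17] [cite: Casselman1980, §3] [cite: BorelJacquet1979, §4.1] -/
theorem apply_mul_mul_evalPlace_eq_of_levels {Y : Sort*} (Φ : localPi E c N J v → Y) (ϖ : (w : PlacesOver E v) → w.1.adicCompletion E)
    (hϖ : ∀ w, Valued.v (ϖ w) = WithZero.exp (-1 : ℤ)) (cv : PlacesOver E v → ℕ)
    (hΦ : ∀ y k : localPi E c N J v,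
      (∀ w : PlacesOver E v, (k : LocalGLPi E N v) w ∈ congruenceGL N (valuation (w.1.adicCompletion E) (ϖ w) ^ cv w)) → Φ (y * k) = Φ y)
    (x : (adelicGroupData F E c N J).Adelic) (a : PlacesOver E v → ℕ)
    (ha : ∀ w : PlacesOver E v, GLn.localHeight N E w.1 (adelicVal F E c N J x) ≤ ((Ideal.absNorm w.1.asIdeal : ℕ) : ℝ≥0) ^ a w)
    (y k : localPi E c N J v)
    (hk : ∀ w : PlacesOver E v, (k : LocalGLPi E N v) w ∈ congruenceGL N (valuation (w.1.adicCompletion E) (ϖ w) ^ (cv w + 2 * a w))) :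
    Φ (y * k * evalPlace F E c N J v (finPart F E c N J x)) = Φ (y * evalPlace F E c N J v (finPart F E c N J x)) := by
  have hconj : y * k * evalPlace F E c N J v (finPart F E c N J x) =
      y * evalPlace F E c N J v (finPart F E c N J x) *
        ((evalPlace F E c N J v (finPart F E c N J x))⁻¹ * k * evalPlace F E c N J v (finPart F E c N J x)) := by group
  rw [hconj]
  exact hΦ _ _ fun w => evalPlace_finPart_conj_apply_mem_congruenceGL F E c N J v x k w (cv w) (a w) (ha w) (hϖ w) (hk w)

end Local

/-! ## §2 The height `H_v = Φ_𝒦 ∘ ι_v` is right-invariant under `ι_v⁻¹(𝒦.K)`, which contains a level -/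

section Height

variable (L : Type) [Field L] [NumberField L] [IsCMField L]
variable {N M n : ℕ} (e : Fin N × Fin M ≃ Fin n)
  (dV : Fin N → L) (hdV : ∀ i, IsCMField.complexConj L (dV i) = dV i) (hdV0 : ∀ i, dV i ≠ 0)
  (dW : Fin M → L) (hdW : ∀ i, IsCMField.complexConj L (dW i) = dW i) (hdW0 : ∀ i, dW i ≠ 0)

include hdV0 hdW0 in
/-- **`H_v(y·k) = H_v(y)` when `ι_v(k) ∈ 𝒦.K`** (`ι_v = locToAdelic v` is a group morphism; ★ `iwasawaHeight_mul_K`, every `𝒦` is `Δ`-unimodular). [cite: Tan1999, §1 p. 166] [cite: BorelJacquet1979, §4.1] -/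
theorem modDelta_pPart_locToAdelic_mul (𝒦 : IwasawaDatum L e dV hdV dW hdW) {v : HeightOneSpectrum (𝓞 (Fp L))}
    (y k : UnitaryGroup.localPi L (IsCMField.complexConj L) (n + n) (hermD L e dV hdV dW hdW) v)
    (hk : (locToAdelic L e dV hdV dW hdW v k : HA L e dV hdV dW hdW) ∈ 𝒦.K) :
    modDelta L e dV hdV dW hdW (𝒦.pPart (locToAdelic L e dV hdV dW hdW v (y * k))) = modDelta L e dV hdV dW hdW (𝒦.pPart (locToAdelic L e dV hdV dW hdW v y)) := by
  rw [map_mul]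
  exact iwasawaHeight_mul_K L e dV hdV hdV0 dW hdW hdW0 𝒦 _ hk

/-- **A LEVEL INSIDE `ι_v⁻¹(𝒦.K)` FOR A STANDARD DATUM**: the finite half `C_f` of `𝒦.K` is OPEN in `H(𝔸_f)` (★ `IwasawaDatum.IsStd.exists_fin`), `ι_v = (1, ·) ∘ inclPlace v` is continuous
(★ `continuous_inclPlace`), so `ι_v⁻¹(𝒦.K) ⊇ inclPlace_v⁻¹(C_f) ∈ 𝓝 1` contains a principal level (§1). [cite: BorelJacquet1979, §4.1] [cite: PlatonovRapinchuk1994, §5.1] -/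
theorem exists_levels_locToAdelic_mem_K {𝒦 : IwasawaDatum L e dV hdV dW hdW} (h𝒦 : 𝒦.IsStd) (v : HeightOneSpectrum (𝓞 (Fp L)))
    (ϖ : (w : UnitaryGroup.PlacesOver L v) → w.1.adicCompletion L) (hϖ : ∀ w, Valued.v (ϖ w) = WithZero.exp (-1 : ℤ)) :
    ∃ m : UnitaryGroup.PlacesOver L v → ℕ, ∀ k : UnitaryGroup.localPi L (IsCMField.complexConj L) (n + n) (hermD L e dV hdV dW hdW) v,
      (∀ w : UnitaryGroup.PlacesOver L v,
        (k : UnitaryGroup.LocalGLPi L (n + n) v) w ∈ congruenceGL (n + n) (valuation (w.1.adicCompletion L) (ϖ w) ^ m w)) →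
      (locToAdelic L e dV hdV dW hdW v k : HA L e dV hdV dW hdW) ∈ 𝒦.K := by
  obtain ⟨Cfin, hopen, hCK, -⟩ := h𝒦.exists_fin
  -- the place inclusion `inclPlace v : H(L⁺_v) →* H(𝔸_f)` (continuous) pulls the open `C_f` back to a neighbourhood of `1`
  have hιc : Continuous (UnitaryGroup.inclPlace (Fp L) L (IsCMField.complexConj L) (n + n) (hermD L e dV hdV dW hdW) v) :=
    UnitaryGroup.continuous_inclPlace (Fp L) L (IsCMField.complexConj L) (n + n) (hermD L e dV hdV dW hdW) v
  have h1 : (1 : UnitaryGroup.localPi L (IsCMField.complexConj L) (n + n) (hermD L e dV hdV dW hdW) v) ∈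
      (UnitaryGroup.inclPlace (Fp L) L (IsCMField.complexConj L) (n + n) (hermD L e dV hdV dW hdW) v) ⁻¹' (Cfin : Set (UnitaryGroup.finAdelic (Fp L) L (IsCMField.complexConj L) (n + n) (hermD L e dV hdV dW hdW))) := by
    rw [Set.mem_preimage, map_one]
    exact Cfin.one_mem
  obtain ⟨m, hm⟩ := exists_levels_forall_mem_of_mem_nhds (Fp L) L (IsCMField.complexConj L) (n + n) (hermD L e dV hdV dW hdW) v
    ((hopen.preimage hιc).mem_nhds h1) ϖ hϖ
  refine ⟨m, fun k hk => ?_⟩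
  -- `ι_v k = finAdelicToAdelic (inclPlace v k)` in the `HA` frame (★ `locToAdelic_eq_finAdelicToAdelic_inclPlace`, `rfl`)
  rw [locToAdelic_eq_finAdelicToAdelic_inclPlace]
  exact hCK _ (hm k hk)

end Height

/-! ## §3 The levels of finitely many smooth functions, and of the `S₀`-factors -/

section Smooth

variable (L : Type) [Field L] [NumberField L] [IsCMField L]
variable {N M n : ℕ} (e : Fin N × Fin M ≃ Fin n)
  (dV : Fin N → L) (hdV : ∀ i, IsCMField.complexConj L (dV i) = dV i)
  (dW : Fin M → L) (hdW : ∀ i, IsCMField.complexConj L (dW i) = dW i)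

set_option maxHeartbeats 400000 in -- MEASURED (probes): unfolding ★ `IsSmooth` at the CM frame `localPi L c (n+n) (hermD …) v` ≈ 4·10⁴ beats per use, the neighbourhood step ≈ 1.2·10⁵, statement ≈ 3·10⁴ (`whnf` of the instance-laden subgroup type; no search tactics) — at the 200 000 line (fails intermittently), 400 000 passes
/-- **FINITELY MANY SMOOTH FUNCTIONS HAVE A COMMON PRINCIPAL LEVEL**: if each `φ i` (`i` in a finite type) is SMOOTH on `H(L⁺_v)` (★ `IsSmooth`: right-invariant under an open
subgroup `U_i`), there are exponents `m_w`, `w ∣ v`, with `φ i (g·k) = φ i (g)` for all `i, g` and every `k` with `k_w ∈ K_w(ϖ_w^{m_w})` (§1 on `⋂_i U_i ∈ 𝓝 1`).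
[cite: Casselman1980, §3] [cite: BorelJacquet1979, §4.1] -/
theorem exists_levels_forall_mul_eq_of_isSmooth {ι : Type*} [Finite ι] (v : HeightOneSpectrum (𝓞 (Fp L)))
    (φ : ι → UnitaryGroup.localPi L (IsCMField.complexConj L) (n + n) (hermD L e dV hdV dW hdW) v → ℂ)
    (hφ : ∀ i, IsSmooth (Fp L) L (IsCMField.complexConj L) v n (JD := hermD L e dV hdV dW hdW) (φ i))
    (ϖ : (w : UnitaryGroup.PlacesOver L v) → w.1.adicCompletion L) (hϖ : ∀ w, Valued.v (ϖ w) = WithZero.exp (-1 : ℤ)) :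
    ∃ m : UnitaryGroup.PlacesOver L v → ℕ, ∀ k : UnitaryGroup.localPi L (IsCMField.complexConj L) (n + n) (hermD L e dV hdV dW hdW) v,
      (∀ w : UnitaryGroup.PlacesOver L v,
        (k : UnitaryGroup.LocalGLPi L (n + n) v) w ∈ congruenceGL (n + n) (valuation (w.1.adicCompletion L) (ϖ w) ^ m w)) →
      ∀ (i : ι) (g : UnitaryGroup.localPi L (IsCMField.complexConj L) (n + n) (hermD L e dV hdV dW hdW) v), φ i (g * k) = φ i g := by
  -- each `φ i` is right-invariant EVENTUALLY near `1` (its smoothness subgroup is a neighbourhood of `1`, Mathlib `OpenSubgroup.mem_nhds_one`)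
  have hsm : ∀ i, ∀ᶠ u in 𝓝 (1 : UnitaryGroup.localPi L (IsCMField.complexConj L) (n + n) (hermD L e dV hdV dW hdW) v),
      ∀ g : UnitaryGroup.localPi L (IsCMField.complexConj L) (n + n) (hermD L e dV hdV dW hdW) v, φ i (g * u) = φ i g := fun i => by
    obtain ⟨U, hU⟩ := hφ i
    exact Filter.mem_of_superset U.mem_nhds_one fun u hu g => hU g u hu
  -- a level inside the (finite) intersection (§1)
  obtain ⟨m, hm⟩ := exists_levels_forall_mem_of_mem_nhds (Fp L) L (IsCMField.complexConj L) (n + n) (hermD L e dV hdV dW hdW) v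
    (Filter.eventually_all.2 hsm) ϖ hϖ
  exact ⟨m, fun k hk => hm k hk⟩

end Smooth

section Reading

variable (L : Type) [Field L] [NumberField L] [IsCMField L]
variable {N M n : ℕ} (e : Fin N × Fin M ≃ Fin n)
  (dV : Fin N → L) (hdV : ∀ i, IsCMField.complexConj L (dV i) = dV i) (hdV0 : ∀ i, dV i ≠ 0)
  (dW : Fin M → L) (hdW : ∀ i, IsCMField.complexConj L (dW i) = dW i) (hdW0 : ∀ i, dW i ≠ 0)

/-- **THE LEVEL OF THE `S₀`-FACTORS AT ONE PLACE**: for a STANDARD datum `𝒦` and local factors `b i ∈ I_v(s₀, χ_v)` (`i : Fin m`; ★ `mem_localDegPS_iff` gives smoothness), there are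
exponents `m_w`, `w ∣ v`, such that every `k` with `k_w ∈ K_w(ϖ_w^{m_w})` fixes all `b i` on the right AND has `ι_v k ∈ 𝒦.K` (so it also fixes `H_v`, §2) — the two levels added,
★ `congruenceGL_mono`. [cite: Casselman1980, §3] [cite: Tan1999, §1 p. 166] [cite: PlatonovRapinchuk1994, §5.1] -/
theorem exists_levels_factors_and_mem_K {𝒦 : IwasawaDatum L e dV hdV dW hdW} (h𝒦 : 𝒦.IsStd) (s₀ : ℂ) {χ : HeckeCharacter L}
    (v : HeightOneSpectrum (𝓞 (Fp L))) {m : ℕ} (b : Fin m → (UnitaryGroup.localPi L (IsCMField.complexConj L) (n + n) (hermD L e dV hdV dW hdW) v → ℂ))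
    (hb : ∀ i, b i ∈ localDegPS (Fp L) L (IsCMField.complexConj L) (complexConj_imagUnit L) (imagUnit_ne_zero L) (imagUnit_mul_self L)
      v n (gramR_isSymm L e dV hdV dW hdW) (hermD_eq_map_gramD L e dV hdV dW hdW) (fun w => χ.localComponent w.1) s₀)
    (ϖ : (w : UnitaryGroup.PlacesOver L v) → w.1.adicCompletion L) (hϖ : ∀ w, Valued.v (ϖ w) = WithZero.exp (-1 : ℤ)) :
    ∃ mv : UnitaryGroup.PlacesOver L v → ℕ, ∀ k : UnitaryGroup.localPi L (IsCMField.complexConj L) (n + n) (hermD L e dV hdV dW hdW) v,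
      (∀ w : UnitaryGroup.PlacesOver L v,
        (k : UnitaryGroup.LocalGLPi L (n + n) v) w ∈ congruenceGL (n + n) (valuation (w.1.adicCompletion L) (ϖ w) ^ mv w)) →
      (∀ (i : Fin m) (g : UnitaryGroup.localPi L (IsCMField.complexConj L) (n + n) (hermD L e dV hdV dW hdW) v), b i (g * k) = b i g) ∧
        (locToAdelic L e dV hdV dW hdW v k : HA L e dV hdV dW hdW) ∈ 𝒦.K := by
  obtain ⟨mU, hmU⟩ := exists_levels_forall_mul_eq_of_isSmooth L e dV hdV dW hdW v b
    (fun i => ((mem_localDegPS_iff (Fp L) L (IsCMField.complexConj L) (complexConj_imagUnit L) (imagUnit_ne_zero L) (imagUnit_mul_self L) v n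
      (gramR_isSymm L e dV hdV dW hdW) (hermD_eq_map_gramD L e dV hdV dW hdW) _ s₀ _).1 (hb i)).2) ϖ hϖ
  obtain ⟨mK, hmK⟩ := exists_levels_locToAdelic_mem_K L e dV hdV dW hdW h𝒦 v ϖ hϖ
  have hle : ∀ (w : UnitaryGroup.PlacesOver L v) (m₁ m₂ : ℕ), m₁ ≤ m₂ →
      congruenceGL (n + n) (valuation (w.1.adicCompletion L) (ϖ w) ^ m₂) ≤ congruenceGL (n + n) (valuation (w.1.adicCompletion L) (ϖ w) ^ m₁) :=
    fun w m₁ m₂ h => congruenceGL_mono (pow_le_pow_right_of_le_one' (isUniformizingElement_of_v_eq (hϖ w)).valuation_le_one h)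
  exact ⟨fun w => mU w + mK w, fun k hk =>
    ⟨hmU k fun w => hle w _ _ (Nat.le_add_right (mU w) (mK w)) (hk w), hmK k fun w => hle w _ _ (Nat.le_add_left (mK w) (mU w)) (hk w)⟩⟩

section Head

variable [DecidableEq (HeightOneSpectrum (𝓞 (Fp L)))]

include hdV0 hdW0 in
/-- **HEAD — THE LOCAL FACTORS OF THE (KW-fac) READING HAVE A PRINCIPAL LEVEL, UNIFORMLY IN `(j, s, S, h)`.**  For a STANDARD Iwasawa datum `𝒦` (`h𝒦`), an abscissa `s₀`, the (KW-fac)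
set `S₀` with `χ` unramified off `S₀` (`hχS₀`), the (KW-fac) local factors `b` with `b_{j,v} ∈ I_v(s₀, χ_v)` on `S₀` (`hb₀`, ★ p863379 ∕ ★ p863597 VERBATIM), any `FvT` with the
(KW-fac) READING `hread` (★ p863446's bytes), and uniformisers `ϖ_w` of the places `w` of `L`: there are a finite set `Tc` of places of `L` and exponents `c : w ↦ ℕ` VANISHING OFF `Tc`
(the `(Tc, c, hc)` bytes of ★ p863047 ∕ ★ p863485's `hsuppLoc`) such that `FvT j S h v s (y · k) = FvT j S h v s (y)` for EVERY `j, S, h, v ∈ kindWFinset T₀ ↑S h, s, y` and every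
`k ∈ H(L⁺_v)` with `k_w ∈ K_w(ϖ_w^{c_w})` for all `w ∣ v`.  Off `S₀`: `FvT = Λ_{s,v}` is right-`K_{H,v}`-invariant (★ `lambdaLoc_mul_localInt`; `K_w(ϖ^c) ≤ GL_N(𝒪_w)` ★
`congruenceGL_le_glInt` + ★ `mem_localInt_iff`), so `c = 0` there; on `S₀`: `exists_levels_factors_and_mem_K` + §2; `Tc` = the places over `S₀`.
[cite: BorelJacquet1979, §4.1] [cite: Casselman1980, §3] [cite: Tan1999, §1 p. 166] [cite: HarrisKudlaSweet1996, §1 (1.15)] [cite: PlatonovRapinchuk1994, §5.1] -/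
theorem exists_levels_forall_FvT_mul_eq {𝒦 : IwasawaDatum L e dV hdV dW hdW} (h𝒦 : 𝒦.IsStd) (s₀ : ℂ) {χ : HeckeCharacter L}
    {S₀ : Finset (HeightOneSpectrum (𝓞 (Fp L)))} (hχS₀ : ∀ v, v ∉ S₀ → ∀ w : UnitaryGroup.PlacesOver L v, χ.IsUnramifiedAt w.1) {m : ℕ}
    (b : Fin m → (v : HeightOneSpectrum (𝓞 (Fp L))) → (UnitaryGroup.localPi L (IsCMField.complexConj L) (n + n) (hermD L e dV hdV dW hdW) v → ℂ))
    (hb₀ : ∀ i, ∀ v ∈ S₀, b i v ∈ localDegPS (Fp L) L (IsCMField.complexConj L) (complexConj_imagUnit L) (imagUnit_ne_zero L) (imagUnit_mul_self L)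
      v n (gramR_isSymm L e dV hdV dW hdW) (hermD_eq_map_gramD L e dV hdV dW hdW) (fun w => χ.localComponent w.1) s₀)
    {T₀ : Finset (HeightOneSpectrum (𝓞 (Fp L)))}
    (FvT : Fin m → ∀ (S : skewMatrices ((IsCMField.complexConj L : L ≃ₐ[Fp L] L) : L →+* L) ((gramR L e dV hdV dW hdW).map (algebraMap (Fp L) L)))
      (h : HA L e dV hdV dW hdW) (v : (kindWFinset L e dV hdV dW hdW T₀ (S : Matrix (Fin n) (Fin n) L) h)),
      ℂ → UnitaryGroup.localPi L (IsCMField.complexConj L) (n + n) (hermD L e dV hdV dW hdW) v.1 → ℂ)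
    (hread : ∀ (j : Fin m) (S : skewMatrices ((IsCMField.complexConj L : L ≃ₐ[Fp L] L) : L →+* L) ((gramR L e dV hdV dW hdW).map (algebraMap (Fp L) L)))
      (h : HA L e dV hdV dW hdW) (v : (kindWFinset L e dV hdV dW hdW T₀ (S : Matrix (Fin n) (Fin n) L) h)) (s : ℂ)
      (y : UnitaryGroup.localPi L (IsCMField.complexConj L) (n + n) (hermD L e dV hdV dW hdW) v.1),
      FvT j S h v s y = if v.1 ∈ S₀ then ((modDelta L e dV hdV dW hdW (𝒦.pPart (locToAdelic L e dV hdV dW hdW v.1 y)) : ℝ) : ℂ) ^ (2 * (s - s₀)) * b j v.1 y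
        else LambdaLoc L e dV hdV dW hdW v.1 χ s y)
    (ϖ : (w : HeightOneSpectrum (𝓞 L)) → w.adicCompletion L) (hϖ : ∀ w, Valued.v (ϖ w) = WithZero.exp (-1 : ℤ)) :
    ∃ (Tc : Finset (HeightOneSpectrum (𝓞 L))) (c : HeightOneSpectrum (𝓞 L) → ℕ), (∀ w ∉ Tc, c w = 0) ∧
      ∀ (j : Fin m) (S : skewMatrices ((IsCMField.complexConj L : L ≃ₐ[Fp L] L) : L →+* L) ((gramR L e dV hdV dW hdW).map (algebraMap (Fp L) L)))
        (h : HA L e dV hdV dW hdW) (v : (kindWFinset L e dV hdV dW hdW T₀ (S : Matrix (Fin n) (Fin n) L) h)) (s : ℂ)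
        (y k : UnitaryGroup.localPi L (IsCMField.complexConj L) (n + n) (hermD L e dV hdV dW hdW) v.1),
        (∀ w : UnitaryGroup.PlacesOver L v.1,
          (k : UnitaryGroup.LocalGLPi L (n + n) v.1) w ∈ congruenceGL (n + n) (valuation (w.1.adicCompletion L) (ϖ w.1) ^ c w.1)) →
        FvT j S h v s (y * k) = FvT j S h v s y := by
  classical
  -- on `S₀`: one level per place (`exists_levels_factors_and_mem_K`)
  have hS := fun (v : HeightOneSpectrum (𝓞 (Fp L))) (hv : v ∈ S₀) =>
    exists_levels_factors_and_mem_K L e dV hdV dW hdW h𝒦 s₀ v (fun i => b i v) (fun i => hb₀ i v hv) (fun w => ϖ w.1) (fun w => hϖ w.1)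
  choose mS hmS using hS
  -- the global exponent function: `mS` over `S₀`, `0` elsewhere; `Tc` = the places over `S₀`
  obtain ⟨c, hcdef⟩ : ∃ c : HeightOneSpectrum (𝓞 L) → ℕ,
      c = fun w => if hw : w.under (𝓞 (Fp L)) ∈ S₀ then mS (w.under (𝓞 (Fp L))) hw ⟨w, rfl⟩ else 0 := ⟨_, rfl⟩
  have hc : ∀ (v : HeightOneSpectrum (𝓞 (Fp L))) (hv : v ∈ S₀) (w : UnitaryGroup.PlacesOver L v), c w.1 = mS v hv w := by
    rintro v hv ⟨w, rfl⟩
    simp only [hcdef, dif_pos hv]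
  refine ⟨S₀.biUnion fun v => (Finset.univ : Finset (UnitaryGroup.PlacesOver L v)).image fun w => w.1, c, fun w hw => ?_, ?_⟩
  · -- `c = 0` off `Tc`
    by_cases hw' : w.under (𝓞 (Fp L)) ∈ S₀
    · refine absurd (Finset.mem_biUnion.2 ⟨w.under (𝓞 (Fp L)), hw', ?_⟩) hw
      exact Finset.mem_image_of_mem (fun w' : UnitaryGroup.PlacesOver L (w.under (𝓞 (Fp L))) => w'.1)
        (Finset.mem_univ (⟨w, rfl⟩ : UnitaryGroup.PlacesOver L (w.under (𝓞 (Fp L)))))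
    · simp only [hcdef, dif_neg hw']
  intro j S h v s y k hk
  rw [hread, hread]
  by_cases hv : v.1 ∈ S₀
  · -- on `S₀`: the flat twist `H_v^{2(s−s₀)}·b_{j,v}`
    rw [if_pos hv, if_pos hv]
    obtain ⟨hbk, hKk⟩ := hmS v.1 hv k fun w => by rw [← hc v.1 hv w]; exact hk w
    rw [modDelta_pPart_locToAdelic_mul L e dV hdV hdV0 dW hdW hdW0 𝒦 y k hKk, hbk j y]
  · -- off `S₀`: the unramified section `Λ_{s,v}`, right-`K_{H,v}`-invariant
    rw [if_neg hv, if_neg hv]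
    refine lambdaLoc_mul_localInt L e dV hdV dW hdW v.1 χ s (hχS₀ v.1 hv) y ?_
    rw [UnitaryGroup.mem_localInt_iff]
    exact fun w => congruenceGL_le_glInt _ (hk w)

end Head

/-! ## §4 The conjugated ∕ translated forms (K2E3-p03's `hFinv`, LEVEL currency) -/

/-- **LOCAL FORM — a right translate by `g ∈ H(L⁺_v)` whose `w`-components (and their inverses) have entries `≤ q_w^{a_w}`**: with the exponents `c` of
`exists_levels_forall_FvT_mul_eq` (its conclusion BY VALUE as `hlev`) and `k_w ∈ K_w(ϖ_w^{c_w + 2a_w})`, `FvT j S h v s (y · k · g) = FvT j S h v s (y · g)` —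
`y·k·g = (y·g)·(g⁻¹·k·g)` and ★ (c5) `conj_apply_mem_congruenceGL` (over ★ (c1)). [cite: HarishChandra1999, §17] [cite: Casselman1980, §3] [cite: BorelJacquet1979, §4.1] -/
theorem FvT_mul_mul_eq_of_levels {m : ℕ} {T₀ : Finset (HeightOneSpectrum (𝓞 (Fp L)))}
    (FvT : Fin m → ∀ (S : skewMatrices ((IsCMField.complexConj L : L ≃ₐ[Fp L] L) : L →+* L) ((gramR L e dV hdV dW hdW).map (algebraMap (Fp L) L)))
      (h : HA L e dV hdV dW hdW) (v : (kindWFinset L e dV hdV dW hdW T₀ (S : Matrix (Fin n) (Fin n) L) h)),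
      ℂ → UnitaryGroup.localPi L (IsCMField.complexConj L) (n + n) (hermD L e dV hdV dW hdW) v.1 → ℂ)
    (ϖ : (w : HeightOneSpectrum (𝓞 L)) → w.adicCompletion L) (hϖ : ∀ w, Valued.v (ϖ w) = WithZero.exp (-1 : ℤ)) (c : HeightOneSpectrum (𝓞 L) → ℕ)
    (hlev : ∀ (j : Fin m) (S : skewMatrices ((IsCMField.complexConj L : L ≃ₐ[Fp L] L) : L →+* L) ((gramR L e dV hdV dW hdW).map (algebraMap (Fp L) L)))
        (h : HA L e dV hdV dW hdW) (v : (kindWFinset L e dV hdV dW hdW T₀ (S : Matrix (Fin n) (Fin n) L) h)) (s : ℂ)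
        (y k : UnitaryGroup.localPi L (IsCMField.complexConj L) (n + n) (hermD L e dV hdV dW hdW) v.1),
        (∀ w : UnitaryGroup.PlacesOver L v.1,
          (k : UnitaryGroup.LocalGLPi L (n + n) v.1) w ∈ congruenceGL (n + n) (valuation (w.1.adicCompletion L) (ϖ w.1) ^ c w.1)) →
        FvT j S h v s (y * k) = FvT j S h v s y)
    (j : Fin m) (S : skewMatrices ((IsCMField.complexConj L : L ≃ₐ[Fp L] L) : L →+* L) ((gramR L e dV hdV dW hdW).map (algebraMap (Fp L) L)))
    (h : HA L e dV hdV dW hdW) (v : (kindWFinset L e dV hdV dW hdW T₀ (S : Matrix (Fin n) (Fin n) L) h)) (s : ℂ)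
    (g : UnitaryGroup.localPi L (IsCMField.complexConj L) (n + n) (hermD L e dV hdV dW hdW) v.1) (a : UnitaryGroup.PlacesOver L v.1 → ℕ)
    (hg : ∀ (w : UnitaryGroup.PlacesOver L v.1) (i i' : Fin (n + n)),
      ‖(((g : UnitaryGroup.LocalGLPi L (n + n) v.1) w : GL (Fin (n + n)) (w.1.adicCompletion L)).val i i')‖₊ ≤ ((Ideal.absNorm w.1.asIdeal : ℕ) : ℝ≥0) ^ a w)
    (hg' : ∀ (w : UnitaryGroup.PlacesOver L v.1) (i i' : Fin (n + n)),
      ‖((((g : UnitaryGroup.LocalGLPi L (n + n) v.1) w)⁻¹ : GL (Fin (n + n)) (w.1.adicCompletion L)).val i i')‖₊ ≤ ((Ideal.absNorm w.1.asIdeal : ℕ) : ℝ≥0) ^ a w)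
    (y k : UnitaryGroup.localPi L (IsCMField.complexConj L) (n + n) (hermD L e dV hdV dW hdW) v.1)
    (hk : ∀ w : UnitaryGroup.PlacesOver L v.1,
      (k : UnitaryGroup.LocalGLPi L (n + n) v.1) w ∈ congruenceGL (n + n) (valuation (w.1.adicCompletion L) (ϖ w.1) ^ (c w.1 + 2 * a w))) :
    FvT j S h v s (y * k * g) = FvT j S h v s (y * g) := by
  have hconj : y * k * g = y * g * (g⁻¹ * k * g) := by simp only [← mul_assoc, mul_inv_cancel_right]
  have H := hlev j S h v s (y * g) (g⁻¹ * k * g) fun w =>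
    conj_apply_mem_congruenceGL (Fp L) L (IsCMField.complexConj L) (n + n) (hermD L e dV hdV dW hdW) v.1 g k w (c w.1) (a w) (hg w) (hg' w) (hϖ w.1) (hk w)
  exact hconj ▸ H

/-- **ADELIC FORM (K2E3-p03's `hFinv`, LEVEL CURRENCY).**  With the exponents `c` of `exists_levels_forall_FvT_mul_eq` (its conclusion BY VALUE as `hlev`): for an adelic point
`x ∈ H(𝔸)` with local heights `H_w(x) ≤ q_w^{a_w}` at the places `w ∣ v` (★ (c1) `exists_localHeight_eq_pow` supplies `a`; `adelicVal x = ↑x`, ★ `adelicVal_apply`) and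
`k ∈ H(L⁺_v)` with `k_w ∈ K_w(ϖ_w^{c_w + 2a_w})`, `FvT j S h v s (y · k · x_v) = FvT j S h v s (y · x_v)`, `x_v = evalPlace v (finPart x)` (the local form at `g := x_v`, entry bounds
★ (c5) `nnnorm_evalPlace_finPart_apply_le`).  At `y := (w_Δ)_v · y`, `k := u₀`, `x := h` this is the body of the level-invariance letter `hFinv` of ★ p863728
`K2LiuKindWFiniteSupportLetterOfLevel.hsuppLoc_of_level` («`FvT(W_v·(y u₀)·h_v) = FvT(W_v·y·h_v)`»), once `u₀ ∈ kindWLocalBall v (π v) (a₀ h v)` is read as a level ((lat-a), NOT here).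
[cite: HarishChandra1999, §17] [cite: Casselman1980, §3] [cite: BorelJacquet1979, §1.2, §4.1] [cite: PlatonovRapinchuk1994, §5.1] -/
theorem FvT_mul_mul_evalPlace_eq {m : ℕ} {T₀ : Finset (HeightOneSpectrum (𝓞 (Fp L)))}
    (FvT : Fin m → ∀ (S : skewMatrices ((IsCMField.complexConj L : L ≃ₐ[Fp L] L) : L →+* L) ((gramR L e dV hdV dW hdW).map (algebraMap (Fp L) L)))
      (h : HA L e dV hdV dW hdW) (v : (kindWFinset L e dV hdV dW hdW T₀ (S : Matrix (Fin n) (Fin n) L) h)),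
      ℂ → UnitaryGroup.localPi L (IsCMField.complexConj L) (n + n) (hermD L e dV hdV dW hdW) v.1 → ℂ)
    (ϖ : (w : HeightOneSpectrum (𝓞 L)) → w.adicCompletion L) (hϖ : ∀ w, Valued.v (ϖ w) = WithZero.exp (-1 : ℤ)) (c : HeightOneSpectrum (𝓞 L) → ℕ)
    (hlev : ∀ (j : Fin m) (S : skewMatrices ((IsCMField.complexConj L : L ≃ₐ[Fp L] L) : L →+* L) ((gramR L e dV hdV dW hdW).map (algebraMap (Fp L) L)))
        (h : HA L e dV hdV dW hdW) (v : (kindWFinset L e dV hdV dW hdW T₀ (S : Matrix (Fin n) (Fin n) L) h)) (s : ℂ)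
        (y k : UnitaryGroup.localPi L (IsCMField.complexConj L) (n + n) (hermD L e dV hdV dW hdW) v.1),
        (∀ w : UnitaryGroup.PlacesOver L v.1,
          (k : UnitaryGroup.LocalGLPi L (n + n) v.1) w ∈ congruenceGL (n + n) (valuation (w.1.adicCompletion L) (ϖ w.1) ^ c w.1)) →
        FvT j S h v s (y * k) = FvT j S h v s y)
    (j : Fin m) (S : skewMatrices ((IsCMField.complexConj L : L ≃ₐ[Fp L] L) : L →+* L) ((gramR L e dV hdV dW hdW).map (algebraMap (Fp L) L)))
    (h : HA L e dV hdV dW hdW) (v : (kindWFinset L e dV hdV dW hdW T₀ (S : Matrix (Fin n) (Fin n) L) h)) (s : ℂ)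
    (x : HA L e dV hdV dW hdW) (a : UnitaryGroup.PlacesOver L v.1 → ℕ)
    (ha : ∀ w : UnitaryGroup.PlacesOver L v.1,
      GLn.localHeight (n + n) L w.1 (UnitaryGroup.adelicVal (Fp L) L (IsCMField.complexConj L) (n + n) (hermD L e dV hdV dW hdW) x) ≤
        ((Ideal.absNorm w.1.asIdeal : ℕ) : ℝ≥0) ^ a w)
    (y k : UnitaryGroup.localPi L (IsCMField.complexConj L) (n + n) (hermD L e dV hdV dW hdW) v.1)
    (hk : ∀ w : UnitaryGroup.PlacesOver L v.1,
      (k : UnitaryGroup.LocalGLPi L (n + n) v.1) w ∈ congruenceGL (n + n) (valuation (w.1.adicCompletion L) (ϖ w.1) ^ (c w.1 + 2 * a w))) :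
    FvT j S h v s (y * k * UnitaryGroup.evalPlace (Fp L) L (IsCMField.complexConj L) (n + n) (hermD L e dV hdV dW hdW) v.1
        (UnitaryGroup.finPart (Fp L) L (IsCMField.complexConj L) (n + n) (hermD L e dV hdV dW hdW) x)) =
      FvT j S h v s (y * UnitaryGroup.evalPlace (Fp L) L (IsCMField.complexConj L) (n + n) (hermD L e dV hdV dW hdW) v.1
        (UnitaryGroup.finPart (Fp L) L (IsCMField.complexConj L) (n + n) (hermD L e dV hdV dW hdW) x)) :=
  FvT_mul_mul_eq_of_levels L e dV hdV dW hdW FvT ϖ hϖ c hlev j S h v s _ a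
    (fun w i i' => (nnnorm_evalPlace_finPart_apply_le (Fp L) L (IsCMField.complexConj L) (n + n) (hermD L e dV hdV dW hdW) v.1 x w i i').1.trans (ha w))
    (fun w i i' => (nnnorm_evalPlace_finPart_apply_le (Fp L) L (IsCMField.complexConj L) (n + n) (hermD L e dV hdV dW hdW) v.1 x w i i').2.trans (ha w)) y k hk

end Reading

end Summit.HodgeConjecture.HodgeConjecture.Cruxes.HLiu418.K2LiuKindWFactorLevelInvariance

end
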